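/-
Copyright (c) 2026 the pub-hodgecm-mathlib formalisation cell (harness21).  Prover seat hodgecm-mathlib-K2E4-p23 (g0) (E4 base on loan to ENGINE E1), Track B ∕ K2-LIT,
h413 = `stmt-HodgeConjecture-24833`, campaign «EIS-R7-BL-SPH-2», brick (β1) (dealer K2E1-plan (g5), RULING «(ρ2b) = G7 PROPER» 2026-09-04T08:48:57Z (1)):
THE CUSP-CONDITION DICTIONARY — from the trunk's `ConstantTermVanishes 𝔓 φ i` on the automorphic quotient to the Borel constant term `borelConstantTerm ν 𝓕 (invQuot φ) ≡ 0` of the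
classical lift, and the door into the BL cusp test class `cuspTestClass` (D8), every rank.
-/
import Summits.HodgeConjecture.HodgeConjecture.Theorems.K2E1BLSpacesU2Defs       -- ★ p858686 (K2E4-p10 g5): `cuspTestClass` (D8), `supHeight` (D5); brings ★ `borelConstantTerm`, ★ `quotFun`
import Literature.NumberTheory.Automorphic.CuspidalSpectrumDiscrete              -- ★ p855263: `ParabolicUnipotentData`, `ConstantTermVanishes`, `cuspForms`
import Literature.NumberTheory.Automorphic.AutomorphicForms                      -- ★ `invQuot 𝒢 f = (g ↦ f [g⁻¹])`, `invQuot_mul_left`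
import HarnessLib

/-!
# K2·E1 — `K2E1CuspConditionDictionaryU` («EIS-R7-BL-SPH-2», brick (β1)): `ConstantTermVanishes 𝔓 φ i` ⟹ `(invQuot φ)_B ≡ 0`, and `cuspForms → cuspTestClass`, every rank

Track B ∕ K2-LIT, crux h413 = `stmt-HodgeConjecture-24833`, route of record `HCCMUnconditional`; cell `hodgecm-mathlib`, squad K2, ENGINE E1, campaign «EIS-R7-BL-SPH-2» ((ζ′) WIRING
7d1cceb628a30de8; RULING «(ρ2b) = G7 PROPER» 08:48:57Z (1)).  Prover seat `hodgecm-mathlib-K2E4-p23` (g0).  THEOREMS ONLY (no `def`, no `instance`, no notation, no named-fact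
hypothesis, no `sorry`); lane `--supports stmt-HodgeConjecture-24833 --as helper` (count-neutral).  Closes no socket.

TWO CURRENCIES OF CUSPIDALITY live in the tree.  (T) The trunk's ★ `AdelicGroupData.ConstantTermVanishes 𝔓 φ i` for a function `φ` ON the automorphic quotient `𝔛 = G(𝔸) ⧸ A_G G(K)`
(a LEFT coset space): for every Borel structure, every Haar `ν` on the radical `N_i(𝔸) = 𝔓.radical i`, every fundamental domain `𝓕` of `N_i(K)` and every `x ∈ G(𝔸)`,
`∫_𝓕 φ([x·u⁻¹]) dν(u) = 0` with its integrability clause (★ `cuspForms μ 𝔓` = continuous ∧ `MemLp 2` ∧ `∀ i` (T)).  (B) Track A's ★ `UnitaryGroup.borelConstantTerm ν 𝓕 Λ g =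
(ν 𝓕)⁻¹ • ∫_𝓕 Λ(u·g) dν(u)` for a CLASSICAL function `Λ` on `G(𝔸) = U(J_N)(𝔸_F)`, `ν` on the Borel radical `N(𝔸) = adelicUnipotent F E c N`, `𝓕` a domain of `N(F) = rationalUnipotent` —
the currency of ★ P7 FILE A `K2E1BLEisensteinCuspOrthogonalU` (`hcusp : ∀ g, borelConstantTerm ν 𝓕 Λ g = 0`) and of the BL cusp test class ★ `cuspTestClass` (D8).  The dictionary
between functions is the trunk's ★ `invQuot 𝒢 φ = (g ↦ φ [g⁻¹])` (left-`A_G G(K)`-invariant, ★ `invQuot_mul_left`), inverse to ★ `quotFun` (§1 `quotFun_invQuot`).  THIS FILE: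
* §1 `quotFun_invQuot` (`quotFun (invQuot φ) = φ`, no hypothesis), `invQuot_mul_left_of_mem_arithmeticSubgroup`, `measurable_invQuot` (for continuous `φ`).
* §2 **`integrableOn_and_setIntegral_invQuot_eq_zero_of_constantTermVanishes`** — for parabolic data `𝔓` of `U(J_N)` whose radical at `i` IS the Borel radical
  (`h𝔓 : 𝔓.radical i = adelicUnipotent F E c N`; the `∀ R, 𝔓.radical i = R → …` ∕ `rintro R rfl` transport of ★ B2₃∕K1₃), every Haar `ν` on `N(𝔸)` and every fundamental domain
  `𝓕` of `N(F)`: `u ↦ (invQuot φ)(u·g)` is integrable on `𝓕` with integral `0` for EVERY `g` ((T) at `x = g⁻¹`, `(u g)⁻¹ = g⁻¹ u⁻¹`); hence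
  **`borelConstantTerm_invQuot_eq_zero_of_constantTermVanishes`**: `borelConstantTerm ν 𝓕 (invQuot φ) g = 0` for all `g` — FILE A's `hcusp`, and its a.e. weakening.
* §3 **`invQuot_mem_cuspTestClass_of_mem_cuspForms`** — for `φ ∈ cuspForms μ 𝔓` (with `h𝔓`) and the ONE extra weight letter `MemLp (w₁^{2k}·φ) 2 μ` of D8 (reduction theory ∕ K1
  rapid decay pays it), `invQuot φ ∈ cuspTestClass k ν 𝓕 μ`: the trunk's cusp forms enter Bernstein–Lapid's (Ξ₃) class by name.
J-DATUM (RULING 08:48:57Z «SAY SO»): everything is typed on Mok's `quasiSplit F E c N` with ABSTRACT parabolic data `𝔓` + `h𝔓` — exactly the shape of ★ B2₃ `…SmoothedCuspFormZeroMean…`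
and ★ K1₃ `…CuspSiegelEstimate…` — so the route's literal reading at `(cmDatum L N Φ_N, cmParabolicData L N, i = 1)` is the ONE `subst`∕`letI` transport of those files' assemblies
(★ `adelicGroupData_eq_cmDatum` is `rfl` not reducibly; ★ `antidiagOne_eq_over`; the radical identity ★ `upperUnitriangular_eq_standardUnipotentRadical_two` at `N = 2`, ★
`comap_flagUnipotentRadical_three_one_eq_adelicUnipotent` at `N = 3`) and is NOT repeated here.
HONEST LABEL: HC_CM is proved only modulo the 7 printed citations (2 remaining named inputs: hLiu418 = `stmt-HodgeConjecture-24832`, h413 = `stmt-HodgeConjecture-24833`)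
until rung 0 closes; this file asserts no named fact and closes no socket.
References: [BorelJacquet1979] A. Borel, H. Jacquet, *Automorphic forms and automorphic representations*, PSPM 33.1 (1979), §4.2, §4.4 · [MoeglinWaldspurger1995] C. Mœglin,
J.-L. Waldspurger, *Spectral Decomposition and Eisenstein Series* (1995), I.2.6, I.2.18 · [BernsteinLapid2019] J. Bernstein, E. Lapid, arXiv:1911.02342, §4 Claim 2.
-/

set_option autoImplicit false
-- the mandated namespace repeats the single-problem summit's segment (`HodgeConjecture.HodgeConjecture`)
set_option linter.dupNamespace false

noncomputable section

open MeasureTheory Measure NumberField IsDedekindDomain Set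
open scoped ENNReal NNReal
open Literature.NumberTheory.Automorphic Literature.NumberTheory.Automorphic.UnitaryGroup AdelicGroupData
open Summit.HodgeConjecture.HodgeConjecture.Cruxes.H413.K2E1BLSpacesU2Defs (cuspTestClass supHeight)

namespace Summit.HodgeConjecture.HodgeConjecture.Cruxes.H413.K2E1CuspConditionDictionaryU

/-! ## §1 The dictionary `invQuot` ∕ `quotFun` -/

section Dictionary

variable {K : Type} [Field K] [NumberField K] (𝒢 : AdelicGroupData K)

/-- **`quotFun (invQuot φ) = φ`** — the two dictionaries `[g] ↦ φ(g̃⁻¹)` and `g ↦ φ[g⁻¹]` are inverse (no hypothesis: `(g̃⁻¹)⁻¹ = g̃` and `[g̃] = x`). [cite: BorelJacquet1979, §4.2] -/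
theorem quotFun_invQuot (φ : 𝒢.automorphicQuotient → ℂ) : 𝒢.quotFun (invQuot 𝒢 φ) = φ := by
  funext x
  change φ (𝒢.toAutomorphicQuotient ((Quotient.out (x : 𝒢.Adelic ⧸ 𝒢.quotientSubgroup))⁻¹)⁻¹) = φ x
  rw [inv_inv]
  exact congrArg φ (QuotientGroup.out_eq' x)

/-- `invQuot φ` is left-invariant under the arithmetic subgroup `G(K)` (★ `invQuot_mul_left`, `G(K) ≤ A_G G(K)`). [cite: BorelJacquet1979, §4.2] -/
theorem invQuot_mul_left_of_mem_arithmeticSubgroup (φ : 𝒢.automorphicQuotient → ℂ) {γ : 𝒢.Adelic} (hγ : γ ∈ 𝒢.arithmeticSubgroup) (g : 𝒢.Adelic) :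
    invQuot 𝒢 φ (γ * g) = invQuot 𝒢 φ g :=
  invQuot_mul_left 𝒢 φ (𝒢.arithmeticSubgroup_le_quotientSubgroup hγ) g

/-- `invQuot φ` is Borel for continuous `φ` (`g ↦ [g⁻¹]` is continuous). [folklore] -/
theorem measurable_invQuot [MeasurableSpace 𝒢.Adelic] [BorelSpace 𝒢.Adelic] {φ : 𝒢.automorphicQuotient → ℂ} (hφ : Continuous φ) : Measurable (invQuot 𝒢 φ) :=
  (hφ.comp (𝒢.continuous_toAutomorphicQuotient.comp continuous_inv)).measurable

end Dictionary

/-! ## §2 `ConstantTermVanishes` at the Borel radical ⟹ `borelConstantTerm ν 𝓕 (invQuot φ) ≡ 0` -/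

section Borel

variable {F E : Type} [Field F] [NumberField F] [Field E] [NumberField E] [Algebra F E] {c : E ≃ₐ[F] E} {N : ℕ}

/-- **(T) ⟹ (B) ON THE DOMAIN**: for parabolic data `𝔓` of `U(J_N)` with `𝔓.radical i = N(𝔸)` (the Borel radical), a function `φ` on `𝔛` with ★ `ConstantTermVanishes 𝔓 φ i`, every Borel
Haar measure `ν` on `N(𝔸)` and every fundamental domain `𝓕` of `N(F)`: for EVERY `g ∈ G(𝔸)` the classical lift satisfies
`IntegrableOn (u ↦ invQuot φ (u·g)) 𝓕 ν ∧ ∫_𝓕 invQuot φ (u·g) dν(u) = 0` ((T) at `x = g⁻¹`: `invQuot φ (u g) = φ[(u g)⁻¹] = φ[g⁻¹ u⁻¹]`; the subgroup identity is transported by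
`rintro R rfl`, the device of ★ B2₃). [cite: BorelJacquet1979, §4.4] [cite: MoeglinWaldspurger1995, I.2.6] -/
theorem integrableOn_and_setIntegral_invQuot_eq_zero_of_constantTermVanishes
    (𝔓 : (quasiSplit F E c N).ParabolicUnipotentData) (i : 𝔓.ι) (h𝔓 : 𝔓.radical i = adelicUnipotent F E c N)
    [MeasurableSpace (adelicUnipotent F E c N)] [BorelSpace (adelicUnipotent F E c N)] (ν : Measure (adelicUnipotent F E c N)) [ν.IsHaarMeasure]
    {𝓕 : Set (adelicUnipotent F E c N)} (h𝓕 : IsFundamentalDomain (rationalUnipotent F E c N) 𝓕 ν)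
    {φ : (quasiSplit F E c N).automorphicQuotient → ℂ} (hφ : ConstantTermVanishes 𝔓 φ i) (g : (quasiSplit F E c N).Adelic) :
    IntegrableOn (fun u : adelicUnipotent F E c N => invQuot (quasiSplit F E c N) φ ((u : (quasiSplit F E c N).Adelic) * g)) 𝓕 ν ∧
      ∫ u in 𝓕, invQuot (quasiSplit F E c N) φ ((u : (quasiSplit F E c N).Adelic) * g) ∂ν = 0 := by
  -- (T) transported to ANY subgroup `R` equal to the radical (here `R = N(𝔸)`)
  have main : ∀ (R : Subgroup (quasiSplit F E c N).Adelic), 𝔓.radical i = R →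
      ∀ [MeasurableSpace R] [BorelSpace R] (νR : Measure R) [νR.IsHaarMeasure] {𝓕R : Set R},
        IsFundamentalDomain ↥(((quasiSplit F E c N).arithmeticSubgroup).comap R.subtype) 𝓕R νR → ∀ x : (quasiSplit F E c N).Adelic,
        IntegrableOn (fun u : R => φ ((quasiSplit F E c N).toAutomorphicQuotient (x * (u : (quasiSplit F E c N).Adelic)⁻¹))) 𝓕R νR ∧
          ∫ u in 𝓕R, φ ((quasiSplit F E c N).toAutomorphicQuotient (x * (u : (quasiSplit F E c N).Adelic)⁻¹)) ∂νR = 0 := by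
    rintro R rfl _ _ νR _ 𝓕R h𝓕R x
    exact hφ νR 𝓕R h𝓕R x
  have key := main (adelicUnipotent F E c N) h𝔓 ν h𝓕 g⁻¹
  have hpt : ∀ u : adelicUnipotent F E c N, invQuot (quasiSplit F E c N) φ ((u : (quasiSplit F E c N).Adelic) * g) =
      φ ((quasiSplit F E c N).toAutomorphicQuotient (g⁻¹ * (u : (quasiSplit F E c N).Adelic)⁻¹)) := fun u => by
    rw [invQuot_apply, mul_inv_rev]
  simp_rw [hpt]
  exact key

/-- **(T) ⟹ (B): THE BOREL CONSTANT TERM OF THE LIFT OF A CUSPIDAL FUNCTION VANISHES IDENTICALLY** — `borelConstantTerm ν 𝓕 (invQuot φ) g = 0` for every `g ∈ G(𝔸)`: exactly the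
hypothesis `hcusp` of ★ P7 FILE A `integral_quotFun_eisensteinSeriesU_mul_conj_eq_zero_of_borelConstantTerm_eq_zero` and the cuspidality clause of ★ `cuspTestClass` (D8).
[cite: BorelJacquet1979, §4.4] [cite: MoeglinWaldspurger1995, I.2.6] -/
theorem borelConstantTerm_invQuot_eq_zero_of_constantTermVanishes
    (𝔓 : (quasiSplit F E c N).ParabolicUnipotentData) (i : 𝔓.ι) (h𝔓 : 𝔓.radical i = adelicUnipotent F E c N)
    [MeasurableSpace (adelicUnipotent F E c N)] [BorelSpace (adelicUnipotent F E c N)] (ν : Measure (adelicUnipotent F E c N)) [ν.IsHaarMeasure]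
    {𝓕 : Set (adelicUnipotent F E c N)} (h𝓕 : IsFundamentalDomain (rationalUnipotent F E c N) 𝓕 ν)
    {φ : (quasiSplit F E c N).automorphicQuotient → ℂ} (hφ : ConstantTermVanishes 𝔓 φ i) (g : (quasiSplit F E c N).Adelic) :
    borelConstantTerm ν 𝓕 (invQuot (quasiSplit F E c N) φ) g = 0 := by
  rw [borelConstantTerm, (integrableOn_and_setIntegral_invQuot_eq_zero_of_constantTermVanishes 𝔓 i h𝔓 ν h𝓕 hφ g).2, smul_zero]

/-- The a.e. weakening (FILE A's `…_of_borelConstantTerm_ae_eq_zero` ∕ `_two` ∕ `_three` input): `borelConstantTerm ν 𝓕 (invQuot φ) = 0` `ν_G`-almost everywhere, for ANY measure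
`ν_G` on `G(𝔸)`. [cite: BorelJacquet1979, §4.4] -/
theorem borelConstantTerm_invQuot_ae_eq_zero_of_constantTermVanishes
    (𝔓 : (quasiSplit F E c N).ParabolicUnipotentData) (i : 𝔓.ι) (h𝔓 : 𝔓.radical i = adelicUnipotent F E c N)
    [MeasurableSpace (adelicUnipotent F E c N)] [BorelSpace (adelicUnipotent F E c N)] (ν : Measure (adelicUnipotent F E c N)) [ν.IsHaarMeasure]
    {𝓕 : Set (adelicUnipotent F E c N)} (h𝓕 : IsFundamentalDomain (rationalUnipotent F E c N) 𝓕 ν)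
    {φ : (quasiSplit F E c N).automorphicQuotient → ℂ} (hφ : ConstantTermVanishes 𝔓 φ i)
    [MeasurableSpace (quasiSplit F E c N).Adelic] (νG : Measure (quasiSplit F E c N).Adelic) :
    ∀ᵐ g : (quasiSplit F E c N).Adelic ∂νG, borelConstantTerm ν 𝓕 (invQuot (quasiSplit F E c N) φ) g = 0 :=
  ae_of_all νG fun g => borelConstantTerm_invQuot_eq_zero_of_constantTermVanishes 𝔓 i h𝔓 ν h𝓕 hφ g

/-- **For a cusp form `φ ∈ cuspForms μ 𝔓`** (★: continuous, `MemLp 2`, all constant terms vanish) the lift `invQuot φ` is Borel, left-`G(F)`-invariant, descends back to `φ`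
(`quotFun (invQuot φ) = φ`), and has vanishing Borel constant term — the four facts every BL consumer (P6 Claim 2, P7 (Ξ₃), P8 (13)) reads. [cite: BorelJacquet1979, §4.4–4.6]
[cite: BernsteinLapid2019, §4 Claim 2] -/
theorem invQuot_package_of_mem_cuspForms
    (𝔓 : (quasiSplit F E c N).ParabolicUnipotentData) (i : 𝔓.ι) (h𝔓 : 𝔓.radical i = adelicUnipotent F E c N)
    [MeasurableSpace (adelicUnipotent F E c N)] [BorelSpace (adelicUnipotent F E c N)] (ν : Measure (adelicUnipotent F E c N)) [ν.IsHaarMeasure]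
    {𝓕 : Set (adelicUnipotent F E c N)} (h𝓕 : IsFundamentalDomain (rationalUnipotent F E c N) 𝓕 ν)
    [MeasurableSpace (quasiSplit F E c N).Adelic] [BorelSpace (quasiSplit F E c N).Adelic]
    {μ : Measure (quasiSplit F E c N).automorphicQuotient} {φ : (quasiSplit F E c N).automorphicQuotient → ℂ} (hφ : φ ∈ (quasiSplit F E c N).cuspForms μ 𝔓) :
    Measurable (invQuot (quasiSplit F E c N) φ) ∧
      (∀ γ ∈ (quasiSplit F E c N).quotientSubgroup, ∀ g : (quasiSplit F E c N).Adelic, invQuot (quasiSplit F E c N) φ (γ * g) = invQuot (quasiSplit F E c N) φ g) ∧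
      (quasiSplit F E c N).quotFun (invQuot (quasiSplit F E c N) φ) = φ ∧
      ∀ g : (quasiSplit F E c N).Adelic, borelConstantTerm ν 𝓕 (invQuot (quasiSplit F E c N) φ) g = 0 :=
  ⟨measurable_invQuot _ hφ.1, fun _ hγ g => invQuot_mul_left _ φ hγ g, quotFun_invQuot _ φ,
    borelConstantTerm_invQuot_eq_zero_of_constantTermVanishes 𝔓 i h𝔓 ν h𝓕 (hφ.2.2 i)⟩

end Borel

/-! ## §3 The door into Bernstein–Lapid's cusp test class `𝒞_k` (D8) -/

section TestClass

variable {F E : Type} [Field F] [NumberField F] [Field E] [NumberField E] [Algebra F E] {c : E ≃ₐ[F] E} {N : ℕ} [NeZero N]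

/-- **`cuspForms → cuspTestClass`**: for `φ ∈ cuspForms μ 𝔓` with `𝔓.radical i = N(𝔸)` and the ONE extra weight letter of D8, `MemLp (w₁^{2k}·φ) 2 μ` (square integrability against
the reduction-theory weight `w₁ = supHeight` — paid by rapid decay ∕ the K1 estimate, not by `cuspForms` itself), the lift `invQuot φ` lies in ★ `cuspTestClass k ν 𝓕 μ`: left-`G(F)`-invariant,
`(invQuot φ)_B ≡ 0`, `quotFun (invQuot φ) = φ ∈ ℒ²(μ)` and the weight clause. [cite: BernsteinLapid2019, §4 Claim 2] [cite: MoeglinWaldspurger1995, I.2.18] -/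
theorem invQuot_mem_cuspTestClass_of_mem_cuspForms
    (𝔓 : (quasiSplit F E c N).ParabolicUnipotentData) (i : 𝔓.ι) (h𝔓 : 𝔓.radical i = adelicUnipotent F E c N)
    [MeasurableSpace (adelicUnipotent F E c N)] [BorelSpace (adelicUnipotent F E c N)] (ν : Measure (adelicUnipotent F E c N)) [ν.IsHaarMeasure]
    {𝓕 : Set (adelicUnipotent F E c N)} (h𝓕 : IsFundamentalDomain (rationalUnipotent F E c N) 𝓕 ν)
    {μ : Measure (quasiSplit F E c N).automorphicQuotient} {φ : (quasiSplit F E c N).automorphicQuotient → ℂ} (hφ : φ ∈ (quasiSplit F E c N).cuspForms μ 𝔓) (k : ℕ)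
    (hw : MemLp (fun x => ((supHeight F E c N x : ℝ) ^ (2 * k) : ℂ) * φ x) 2 μ) :
    invQuot (quasiSplit F E c N) φ ∈ cuspTestClass F E c N k ν 𝓕 μ := by
  refine ⟨fun _ hγ g => invQuot_mul_left _ φ hγ g, fun g => borelConstantTerm_invQuot_eq_zero_of_constantTermVanishes 𝔓 i h𝔓 ν h𝓕 (hφ.2.2 i) g, ?_, ?_⟩
  · rw [quotFun_invQuot]
    exact hφ.2.1
  · rw [quotFun_invQuot]
    exact hw

end TestClass

end Summit.HodgeConjecture.HodgeConjecture.Cruxes.H413.K2E1CuspConditionDictionaryU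

end
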